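import Literature.AlgebraicGeometry.HodgeTheory.UnitaryTwoTwoFourfoldHodgeClasses
import Literature.AlgebraicGeometry.HodgeTheory.AlgebraicClassesCupAbelianVarietyDiagonal
import Literature.RepresentationTheory.ClassicalInvariants.TensorFFTSpecialLinear
import HarnessLib

/-!
# Hodge classes on the powers of an abelian fourfold whose endomorphism algebra is an imaginary quadratic field of
# signature `(2,2)`: every Hodge class is algebraic modulo the Weil classes `W_K(A)`
# (Moonen–Zarhin 1995, row «type IV(1,1), (2,2)»: `B•(Xⁿ) = ⟨D, W_K⟩`; van Geemen 1994 Thm. 6.12)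

Topic `Literature/AlgebraicGeometry/HodgeTheory`; sequel of `UnitaryTwoTwoCodimTwoHodgeClasses` (codimension 2) and
`UnitaryTwoTwoFourfoldHodgeClasses` (`B = A`), using the tensor first fundamental theorem for `SL_n` in the word model
(`ClassicalInvariants/TensorFFTSpecialLinear`: `mem_span_slBasicTensor_of_forall_trace`). Written for the cell
`pub-hodge-ring2` (HONEST FRAMING of that cell: research route conditional on HC_CM; not a corollary;
Q11.4-sentence-2 already refuted in dim ≥ 3), Literature lane gen 69, programme R46-C (heir item (H1a) (ii) of gen 68:
«all codimensions, all powers»). Theorems only (no public definition, no named fact, D-0026), no `sorry`.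

THE MATHEMATICS (Moonen–Zarhin 1995; van Geemen 1994 Thm. 6.11–6.12; Goodman–Wallach §9.1.4 Ex. 4). Let `A` be an
abelian fourfold with `φ ≫ φ = -d` (`d > 0`), `finrank_ℚ End⁰(A) = 2` (`End⁰(A) = ℚ(φ) = K`) and multiplicities `(2,2)`,
and `B` an abelian variety with slots `g_j : B → A` (`AVSlots`: e.g. `B = Aⁿ`). By the invariance theorem of the tree
(`AVSlots.exists_unitaryInvariant_coeff_twoTwo`) a rational `(p,p)`-class on `B` is `Σ_w a(w)·(g e, g f)_w` for letters
`g_j^* e_ℓ` (`e_ℓ ∈ W`, the `i√d`-eigenspace of `φ^*` on `H¹(A, ℂ)`, `dim W = 4`) and `g_j^* f_ℓ` (`f_ℓ ∈ W'` the dual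
basis of the `−i√d`-eigenspace), with every slice of `a` killed by `𝔰𝔩(W) = 𝔰𝔩₄`. The tensor FFT for `SL₄` makes each
slice a combination of the basic invariants `slBasicTensor ty m β = ∏_{pairs} δ ⊗ ε^{⊗m}` (`b` contractions of a
`W`-position with a `W'`-position and `m` determinant blocks of four `W`-positions — or, for slices with more `W'`- than
`W`-positions, the same with `W ↔ W'`). MAIN COMPUTATION (§3, `sum_slBasicTensor_smul_cupPowOne_mem_algebraicClasses`):
the value of a basic invariant on the letters is, up to the sign of the layout permutation,
`(Σ_λ ∏_c θ_c(λ)) ⌣ Ω_{t}(j_1) ⌣ ⋯ ⌣ Ω_{t}(j_m)` — a product of crossed classes `Σ_ℓ g_j^* e_ℓ ⌣ g_{j'}^* f_ℓ ∈ B¹(B) ⊗ ℂ`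
(Milne Prop. 3.6 (c), the tree's `Milne1999.sum_cupPowOne_glPairWord_mem`: in `D^b(B) ⊗ ℂ`) times Weil-type classes
`Ω_t(j) = Σ_{σ ∈ 𝔖₄} sgn σ · (g_{j 0}^* cb(t,σ 0) ⌣ ⋯ ⌣ g_{j 3}^* cb(t,σ 3))`. By POLARIZATION (§5,
`sum_sign_smul_cupPowOne_map_eq_sum_powerset`): `Ω_t(j) = Σ_{S ⊆ {0,…,3}} (−1)^{4−#S} (Σ_{s∈S} g_{j s})^*(cb(t,0) ⌣ ⋯ ⌣ cb(t,3))`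
with `cb(t,0) ⌣ ⋯ ⌣ cb(t,3) ∈ ⋀⁴W ⊕ ⋀⁴W' = W_K ⊗ ℂ`, the Weil plane of `A`. Hence (§6):

* **`AVSlots.hodgeConjectureFor_of_unitaryTwoTwo_of_weilClasses`** — THE HODGE CONJECTURE FOR EVERY ABELIAN VARIETY
  WITH SLOTS OVER `A` (all powers `Aⁿ`, all products of such), GRANTED ONLY that the rational `(2,2)` Weil classes of
  `(A, φ)` are algebraic (hypothesis `hWalg`, the `(A, φ)`-slice of Markman's claim; e.g. Schoen 1988 for
  `K = ℚ(√-3), ℚ(i)` with `det H = 1`). This is Moonen–Zarhin 1995's row «IV(1,1), (2,2)»: «`B•(Xⁿ) = ⟨D, W_K⟩`, HC for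
  all powers of `X` ⟸ the Weil classes are algebraic», read through algebraicity and for ALL such `A` (no genericity).
* `AVSlots.hodgeConjectureFor_of_unitaryTwoTwo_of_hodgeConjectureFor` — `HC(A) ⟹ HC(B)` for every `B` with slots over `A`.
* `AVSlots.hodgeConjectureFor_of_unitaryTwoTwo_of_markman`, `hodgeConjectureFor_powSucc_of_unitaryTwoTwo_of_markman` — the
  same from the tree's named fact `Markman2025_weilClasses_algebraic_abelianFourfold` (a HYPOTHESIS; claim under review).
* **`AVSlots.hodgeConjectureFor_of_isSimple_fourfold_of_finrank_end_eq_two_of_markman`**,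
  `hodgeConjectureFor_powSucc_of_isSimple_fourfold_of_finrank_end_eq_two_of_markman` — THE WHOLE TYPE IV(1,1) ROW WITH
  ALL POWERS: for a SIMPLE fourfold with `End⁰(A)` imaginary quadratic the multiplicities are `(3,1)`/`(1,3)` (Ribet:
  `B = D` unconditionally, the tree's `AVSlots.isDivisorGenerated_of_ribetTypeOne`) or `(2,2)` (this file).
* On the way, unconditionally: `AVSlots.hodgeClasses_algebraic_of_weilClasses_twoTwo` (§4, the abstract form with the
  `Ω_t(j)` as hypotheses), `sum_sign_smul_cupPowOne_avLetters_mem_algebraicClasses_of_weilClassesOf` (§6, the `Ω_t(j)` are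
  algebraic once `W_K ⊗ ℂ ≤` algebraic classes), and the word-model lemmas of §§1–2 (reordering positions under an
  alternating map; Fubini for appended positions; evaluation of the pair-contraction tensor into `D^b` and of the
  determinant blocks into cup products of antisymmetrisations).

NOT here: the structural statement `B•(B) = ⟨D, Ω⟩` as an equality / dimension counts; the algebraicity of `W_K` itself.

## References
* [MoonenZarhin1995Duke] B. Moonen, Yu. Zarhin, Hodge classes and Tate classes on simple abelian fourfolds, Duke
  Math. J. 77 (1995) 553–581, main theorem, row «type IV(1,1), (2,2)»: `B•(Xⁿ) = ⟨D, W_K⟩` (cite-only, acq-04933).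
* [vanGeemen1994HodgeAV] B. van Geemen, An introduction to the Hodge conjecture for abelian varieties, LNM 1594
  (1994), 4.8, 4.9, Lemma 5.2, Lemma 5.4, Thm. 6.11, Thm. 6.12.
* [MoonenZarhin1999LowDim] B. Moonen, Yu. Zarhin, Hodge classes on abelian varieties of low dimension, Math. Ann.
  315 (1999), §2 (2.3), (2.4), (2.5) (2).
* [GoodmanWallachGTM255] R. Goodman, N. Wallach, Symmetry, Representations, and Invariants, GTM 255 (2009), §4.1.1,
  Thm. 5.3.1, §9.1.4 Exercise 4 (tensor invariants of `SL(V)`: complete contractions times determinants).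
* [Milne1999LefschetzClasses] J. S. Milne, Lefschetz classes on abelian varieties, Duke Math. J. 96 (1999), Prop. 3.3,
  Prop. 3.6 (c), Remark 3.7.
* [VoisinHodgeII2003] C. Voisin, Hodge Theory and Complex Algebraic Geometry II, Prop. 9.20 (cup products of algebraic
  classes on abelian varieties, via the tree's `AbelianVariety.cupProduct_mem_algebraicClasses'`).
* [Hatcher2002] A. Hatcher, Algebraic Topology (2002), §3.2, Prop. 3.10, Thm. 3.11.
* [LangeBirkenhake1992] H. Lange, Ch. Birkenhake, Complex Abelian Varieties (1992), §1.1 (additivity of `f ↦ f^*` on `H¹`).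
* [Ribet1983] K. A. Ribet, Hodge classes on certain types of abelian varieties, Amer. J. Math. 105 (1983), Thm. 3.
* [Markman2025SurveySecant] E. Markman, arXiv:2509.23403, Thm. 1.2 (claim, under review).
-/

noncomputable section

open scoped TensorProduct
open scoped Matrix
open CategoryTheory Module

namespace Literature.AlgebraicGeometry.HodgeTheory

open Literature.AlgebraicTopology.SingularHomology
open Literature.AlgebraicGeometry.Motives (IsSmoothProjective AbelianVariety bettiCohomology
  ofRatClassBaseChange HodgeTensorFacts hodgeTensorFacts_holds)
open Literature.Barriers.HodgeConjecture
open Literature.AlgebraicGeometry.Motives.HodgeStructure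
open Literature.RepresentationTheory.GeneralLinear
open Literature.RepresentationTheory.ClassicalInvariants
open Literature.NumberTheory.DiophantineGeometry

/-! ### §1 Word-model lemmas: reordering the positions, Fubini for appended positions -/

section WordModel

variable {K : Type*} [Field K] {M V : Type*} [AddCommGroup M] [Module K M] [AddCommGroup V] [Module K V]
  {N d : ℕ}

/-- `ℤˣ`-scalars act through `K`. [folklore] -/
private theorem units_smul_eq_cast_smul (s : ℤˣ) (x : V) : s • x = ((s : ℤ) : K) • x := by
  rw [Units.smul_def, Int.cast_smul_eq_zsmul]

/-- **Reordering the positions of an alternating evaluation.** For an alternating `F` on `d` arguments, a coefficient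
function `f`, position-dependent letters `z q ℓ` and a permutation `σ` of the positions:
`Σ_ε f(ε) F(q ↦ z_q(ε q)) = sgn(σ) Σ_ε f(ε ∘ σ⁻¹) F(q ↦ z_{σ q}(ε q))` (`F(v) = sgn(σ) F(v ∘ σ)` and the change of
variables `ε ↦ ε ∘ σ`). [cite: GoodmanWallachGTM255, §9.1.4 Exercise 4 (the factors `σ_q(ℂ[𝔖_q])`)] -/
theorem sum_smul_eq_sign_smul_sum_comp_perm (F : M [⋀^Fin d]→ₗ[K] V) (f : Word N d → K)
    (z : Fin d → Fin N → M) (σ : Equiv.Perm (Fin d)) :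
    ∑ ε : Word N d, f ε • F (fun q => z q (ε q)) =
      (((Equiv.Perm.sign σ : ℤˣ) : ℤ) : K) •
        ∑ ε : Word N d, f (ε ∘ ⇑σ.symm) • F (fun q => z (σ q) (ε q)) := by
  classical
  have h1 : ∀ ε : Word N d, F (fun q => z q (ε q)) =
      (((Equiv.Perm.sign σ : ℤˣ) : ℤ) : K) • F (fun q => z (σ q) ((ε ∘ ⇑σ) q)) := by
    intro ε
    rw [F.map_congr_perm (fun q => z q (ε q)) σ, units_smul_eq_cast_smul (K := K)]
    rfl
  rw [Finset.smul_sum]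
  refine Fintype.sum_equiv (Equiv.arrowCongr σ.symm (Equiv.refl (Fin N))) _ _ fun ε => ?_
  have he : (Equiv.arrowCongr σ.symm (Equiv.refl (Fin N))) ε = ε ∘ ⇑σ := by
    funext q
    simp [Equiv.arrowCongr_apply]
  have hback : (ε ∘ ⇑σ) ∘ ⇑σ.symm = ε := by
    funext q
    simp
  rw [he, hback, h1 ε, smul_smul, smul_smul, mul_comm]

variable {Y : Type} [TopologicalSpace Y]

/-- Bilinearity of the cup product against two finite linear combinations. [folklore] -/
private theorem cupProduct_sum_smul_sum_smul {a b c : ℕ} (h : a + b = c) {ι₁ ι₂ : Type*} [Fintype ι₁]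
    [Fintype ι₂] (r : ι₁ → ℂ) (x : ι₁ → singularCohomology ℂ ℂ Y a) (s : ι₂ → ℂ)
    (y : ι₂ → singularCohomology ℂ ℂ Y b) :
    cupProduct h (∑ i, r i • x i) (∑ j, s j • y j) = ∑ i, ∑ j, (r i * s j) • cupProduct h (x i) (y j) := by
  rw [map_sum (cupProduct h) (fun i => r i • x i) Finset.univ, LinearMap.sum_apply]
  refine Finset.sum_congr rfl fun i _ => ?_
  rw [map_smul, LinearMap.smul_apply, map_sum, Finset.smul_sum]
  refine Finset.sum_congr rfl fun j _ => ?_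
  rw [map_smul, smul_smul]

/-- **Fubini for appended positions.** On `d = d₁ + d₂` positions, the evaluation of an external product `f₁ ⊗ f₂`
against the iterated cup product of position-dependent degree-one classes splits as the cup product of the two
evaluations: `Σ_ε (f₁ ⊗ f₂)(ε) (z(ε))^{⌣} = (Σ_{ε₁} f₁(ε₁) z¹(ε₁)^{⌣}) ⌣ (Σ_{ε₂} f₂(ε₂) z²(ε₂)^{⌣})` (bilinearity
and `(u ⌣ ⋯) ⌣ (v ⌣ ⋯) = (u,v)^{⌣}`, Hatcher §3.2). [cite: Hatcher2002, §3.2 (p. 211)]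
[cite: GoodmanWallachGTM255, §9.1.4 Exercise 4 (b)] -/
theorem sum_appendFun_smul_cupPowOne {d₁ d₂ : ℕ} (h : d₁ + d₂ = d) (f₁ : Word N d₁ → ℂ) (f₂ : Word N d₂ → ℂ)
    (z : Fin d → Fin N → singularCohomology ℂ ℂ Y 1) :
    ∑ ε : Word N d, appendFun ℂ f₁ f₂ (fun q => ε (Fin.cast h q)) • cupPowOne ℂ Y d (fun q => z q (ε q)) =
      cupProduct h (∑ ε₁ : Word N d₁, f₁ ε₁ • cupPowOne ℂ Y d₁ (fun i => z (Fin.cast h (Fin.castAdd d₂ i)) (ε₁ i)))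
        (∑ ε₂ : Word N d₂, f₂ ε₂ • cupPowOne ℂ Y d₂ (fun j => z (Fin.cast h (Fin.natAdd d₁ j)) (ε₂ j))) := by
  classical
  subst h
  simp only [Fin.cast_eq_self]
  rw [cupProduct_sum_smul_sum_smul, ← Fintype.sum_prod_type']
  refine Fintype.sum_equiv (Fin.appendEquiv d₁ d₂).symm _ _ fun ε => ?_
  -- the word of classes is the appended word of its two parts
  have hword : (fun q => z q (ε q)) = Fin.append (fun i => z (Fin.castAdd d₂ i) (ε (Fin.castAdd d₂ i)))
      (fun j => z (Fin.natAdd d₁ j) (ε (Fin.natAdd d₁ j))) := by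
    funext q
    refine Fin.addCases (fun i => ?_) (fun j => ?_) q
    · rw [Fin.append_left]
    · rw [Fin.append_right]
  rw [hword, ← cupProduct_cupPowOne_cupPowOne]
  simp only [Fin.appendEquiv_symm_apply]
  rfl

/-- **An indicator sum over words collapses** (`Σ_v (∏_j δ_{a j, v j}) G(v) = G(a)`). [folklore] -/
private theorem sum_prod_ite_smul_eq {m : ℕ} (a : Word N m) (G : Word N m → V) :
    ∑ v : Word N m, (∏ j, if a j = v j then (1 : K) else 0) • G v = G a := by
  classical
  rw [Finset.sum_eq_single a]
  · rw [Finset.prod_eq_one fun j _ => if_pos rfl, one_smul]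
  · intro v _ hv
    obtain ⟨j, hj⟩ := Function.ne_iff.1 hv
    rw [Finset.prod_eq_zero (Finset.mem_univ j) (if_neg (Ne.symm hj)), zero_smul]
  · intro h
    exact absurd (Finset.mem_univ a) h

/-- A sum over all words `Fin m → Fin m` of a function vanishing off the bijective words is the sum over the
permutations. [folklore] -/
private theorem sum_word_eq_sum_perm' {m : ℕ} (f : Word m m → V) (hf : ∀ w, ¬ Function.Bijective w → f w = 0) :
    ∑ w : Word m m, f w = ∑ σ : Equiv.Perm (Fin m), f ⇑σ := by
  classical
  let emb : Equiv.Perm (Fin m) ↪ (Fin m → Fin m) := ⟨fun σ => ⇑σ, Equiv.coe_fn_injective⟩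
  change ∑ w, f w = ∑ σ, f (emb σ)
  rw [← Finset.sum_map Finset.univ emb f]
  refine (Finset.sum_subset (Finset.subset_univ _) fun w _ hw => hf w fun hb => hw ?_).symm
  exact Finset.mem_map.2 ⟨Equiv.ofBijective w hb, Finset.mem_univ _, rfl⟩

/-- **Evaluating the determinant tensor**: `Σ_v ε(v) G(v) = Σ_{σ ∈ 𝔖} sgn(σ) G(σ)` — the antisymmetrisation
(the bracket `[v_1 ⋯ v_n]`). [cite: GoodmanWallachGTM255, §9.1.4 Exercise 4 (c)] -/
theorem sum_detTensor_smul_eq {m : ℕ} (G : Word m m → V) :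
    ∑ v : Word m m, detTensor K m v • G v =
      ∑ σ : Equiv.Perm (Fin m), (((Equiv.Perm.sign σ : ℤˣ) : ℤ) : K) • G ⇑σ := by
  rw [sum_word_eq_sum_perm' (fun v => detTensor K m v • G v)
    (fun v hv => by rw [detTensor_of_not_bijective hv, zero_smul])]
  simp_rw [detTensor_perm]

end WordModel

/-! ### §2 Pairs and blocks: the contraction part gives divisor classes, the determinant blocks give Weil-type classes -/

section PairsBlocks

variable {B : AbelianVariety ℂ} {ι' : Type*}

/-- The two elements of `Fin 2` (local copy). [folklore] -/
private theorem fin2_cases₃ (r : Fin 2) : r = 0 ∨ r = 1 := by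
  rcases r with ⟨_ | _ | k, hk⟩
  · exact Or.inl rfl
  · exact Or.inr rfl
  · omega

/-- **The contraction part evaluates into `D^b ⊗ ℂ`.** On `2b` positions laid out in consecutive pairs
(`posEquiv b (c, 0)`, `posEquiv b (c, 1)`), the sum of the pair-contraction tensor `∏_c δ_{ε(c,0), ε(c,1)}` against the
iterated cup product of letters `y(I c, ·)` / `y(J c, ·)` is `Σ_λ (glPairWord y I J λ)^{⌣}`, a product of the crossed
classes `Σ_ℓ y(I c, ℓ) ⌣ y(J c, ℓ)`; if these lie in `B¹(B) ⊗ ℂ` the sum lies in `D^b(B) ⊗ ℂ` (Milne Prop. 3.6 (c),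
the tree's `Milne1999.sum_cupPowOne_glPairWord_mem`). [cite: Milne1999LefschetzClasses, Prop. 3.6 (c) and Remark 3.7]
[cite: GoodmanWallachGTM255, Thm. 5.3.1] -/
theorem sum_pairTensor_smul_cupPowOne_mem_divisorClassesSpan (y : ι' × Fin 4 → complexBetti B.X 1) {b : ℕ}
    (I J : Fin b → ι')
    (hθ : ∀ c, (∑ ℓ : Fin 4, cupProduct (rfl : 1 + 1 = 2) (y (I c, ℓ)) (y (J c, ℓ))) ∈
      Submodule.span ℂ {x : complexBetti B.X 2 | IsRationalClass x ∧ IsOfHodgeType B.dim B.X 2 1 1 x}) :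
    (∑ ε : Word 4 (2 * b), (∏ c : Fin b, if ε (posEquiv b (c, 0)) = ε (posEquiv b (c, 1)) then (1 : ℂ) else 0) •
        cupPowOne ℂ (Motives.ComplexPoints B.X) (2 * b)
          (fun q => y (if ((posEquiv b).symm q).2 = 0 then I ((posEquiv b).symm q).1 else J ((posEquiv b).symm q).1,
            ε q))) ∈ divisorClassesSpan B.X B.dim b := by
  classical
  -- the words constant along the pairs are parametrised by their letters on the pairs
  let ofLam : (Fin b → Fin 4) → Word 4 (2 * b) := fun lam q => lam ((posEquiv b).symm q).1
  have hind : ∀ ε : Word 4 (2 * b),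
      (∏ c : Fin b, if ε (posEquiv b (c, 0)) = ε (posEquiv b (c, 1)) then (1 : ℂ) else 0) =
        ∑ lam : Fin b → Fin 4, if ε = ofLam lam then 1 else 0 := by
    intro ε
    by_cases h : ∀ c, ε (posEquiv b (c, 0)) = ε (posEquiv b (c, 1))
    · rw [Finset.prod_eq_one fun c _ => if_pos (h c), Finset.sum_eq_single (fun c => ε (posEquiv b (c, 0)))]
      · rw [if_pos]
        funext q
        obtain ⟨⟨c, r⟩, rfl⟩ := (posEquiv b).surjective q
        change ε (posEquiv b (c, r)) = ε (posEquiv b (((posEquiv b).symm (posEquiv b (c, r))).1, 0))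
        rw [Equiv.symm_apply_apply]
        rcases fin2_cases₃ r with rfl | rfl
        · rfl
        · exact (h c).symm
      · intro lam _ hlam
        rw [if_neg]
        rintro rfl
        exact hlam (funext fun c => by
          change lam c = lam ((posEquiv b).symm (posEquiv b (c, 0))).1
          rw [Equiv.symm_apply_apply])
      · intro hh
        exact absurd (Finset.mem_univ _) hh
    · push Not at h
      obtain ⟨c, hc⟩ := h
      rw [Finset.prod_eq_zero (Finset.mem_univ c) (if_neg hc)]
      refine (Finset.sum_eq_zero fun lam _ => if_neg ?_).symm
      rintro rfl
      apply hc
      change lam ((posEquiv b).symm (posEquiv b (c, 0))).1 = lam ((posEquiv b).symm (posEquiv b (c, 1))).1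
      rw [Equiv.symm_apply_apply, Equiv.symm_apply_apply]
  simp_rw [hind, Finset.sum_smul, ite_smul, one_smul, zero_smul]
  rw [Finset.sum_comm]
  simp_rw [Finset.sum_ite_eq', if_pos (Finset.mem_univ _)]
  exact Milne1999.sum_cupPowOne_glPairWord_mem y b I J hθ

/-- The position of the `i`-th letter of the `k`-th block among `4m` block positions: `i + 4k`. [folklore] -/
private def blockPos (m : ℕ) (k : Fin m) (i : Fin 4) : Fin (2 * (2 * m)) :=
  ⟨i + 4 * k, by omega⟩

/-- The block layout `(k, i) ↦ i + 4k` is a bijection `Fin m × Fin 4 ≃ Fin 4m`. [folklore] -/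
private theorem blockPos_bijective (m : ℕ) : Function.Bijective fun ki : Fin m × Fin 4 => blockPos m ki.1 ki.2 := by
  rw [Fintype.bijective_iff_injective_and_card]
  refine ⟨?_, by simp [Fintype.card_prod, Fintype.card_fin]; ring⟩
  rintro ⟨k, i⟩ ⟨k', i'⟩ h
  have h' := congrArg Fin.val h
  simp only [blockPos] at h'
  have hk : (k : ℕ) = k' := by omega
  have hi : (i : ℕ) = i' := by omega
  exact Prod.ext (Fin.ext hk) (Fin.ext hi)

/-- Block `castSucc k` of `m + 1` blocks sits inside the first `4m` positions. [folklore] -/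
private theorem blockPos_castSucc (m : ℕ) (h : 2 * (2 * m) + 2 * 2 = 2 * (2 * (m + 1))) (k : Fin m) (i : Fin 4) :
    blockPos (m + 1) (Fin.castSucc k) i = Fin.cast h (Fin.castAdd (2 * 2) (blockPos m k i)) :=
  Fin.ext (by simp [blockPos])

/-- The last block of `m + 1` blocks is the appended block. [folklore] -/
private theorem blockPos_last (m : ℕ) (h : 2 * (2 * m) + 2 * 2 = 2 * (2 * (m + 1))) (i : Fin 4) :
    blockPos (m + 1) (Fin.last m) i = Fin.cast h (Fin.natAdd (2 * (2 * m)) i) :=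
  Fin.ext (by simp [blockPos]; ring)

/-- **The determinant blocks evaluate into products of Weil-type classes.** On `4m` positions in `m` consecutive blocks,
the sum of the block tensor `∏_k ε(block_k)` against the iterated cup product of position-dependent letters is the cup
product of the `m` antisymmetrisations `Σ_σ sgn σ · (z_{(k,0)}(σ 0) ⌣ ⋯ ⌣ z_{(k,3)}(σ 3))`; if each of these is
algebraic (of codimension `2`), so is the sum (codimension `2m`; algebraic classes on an abelian variety are closed
under cup product, Voisin II Prop. 9.20 = the tree's `AbelianVariety.cupProduct_mem_algebraicClasses'`).
[cite: GoodmanWallachGTM255, §9.1.4 Exercise 4 (c)] [cite: VoisinHodgeII2003, Prop. 9.20] -/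
theorem sum_blockTensor_smul_cupPowOne_mem_algebraicClasses :
    ∀ (m : ℕ) (z : Fin (2 * (2 * m)) → Fin 4 → complexBetti B.X 1),
      (∀ k : Fin m, (∑ σ : Equiv.Perm (Fin 4), (((Equiv.Perm.sign σ : ℤˣ) : ℤ) : ℂ) •
        cupPowOne ℂ (Motives.ComplexPoints B.X) 4 (fun i => z (blockPos m k i) (σ i))) ∈ algebraicClasses B.X 2) →
      (∑ ε : Word 4 (2 * (2 * m)), (∏ k : Fin m, detTensor ℂ 4 (fun i => ε (blockPos m k i))) •
        cupPowOne ℂ (Motives.ComplexPoints B.X) (2 * (2 * m)) (fun q => z q (ε q))) ∈ algebraicClasses B.X (2 * m)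
  | 0, z, _ => hodgeConjectureFor_codim_zero _
  | m + 1, z, hz => by
    classical
    have h : 2 * (2 * m) + 2 * 2 = 2 * (2 * (m + 1)) := by ring
    -- the block tensor of `m + 1` blocks is the block tensor of `m` blocks times `ε` on the appended block
    have htensor : ∀ ε : Word 4 (2 * (2 * (m + 1))),
        (∏ k : Fin (m + 1), detTensor ℂ 4 (fun i => ε (blockPos (m + 1) k i))) =
          appendFun ℂ (fun ε₁ : Word 4 (2 * (2 * m)) => ∏ k : Fin m, detTensor ℂ 4 (fun i => ε₁ (blockPos m k i)))
            (detTensor ℂ 4) (fun q => ε (Fin.cast h q)) := by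
      intro ε
      rw [Fin.prod_univ_castSucc]
      simp only [appendFun, blockPos_castSucc m h, blockPos_last m h]
    simp_rw [htensor]
    rw [sum_appendFun_smul_cupPowOne h]
    refine AbelianVariety.cupProduct_mem_algebraicClasses' B h ?_ ?_
    · refine sum_blockTensor_smul_cupPowOne_mem_algebraicClasses m _ fun k => ?_
      have hk := hz (Fin.castSucc k)
      simp only [blockPos_castSucc m h] at hk
      exact hk
    · rw [sum_detTensor_smul_eq]
      have hk := hz (Fin.last m)
      simp only [blockPos_last m h] at hk
      exact hk

end PairsBlocks

/-! ### §3 The layout permutation of a basic `SL`-invariant and its evaluation -/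

section Layout

variable {p b m : ℕ} (ty : Fin (2 * p) → Bool)
  (β : ({q : Fin (2 * p) // ty q = false} ⊕ (Fin m × Fin 4)) ≃ {q : Fin (2 * p) // ty q = true})

/-- The standard layout of `2p = 2b + 4m` positions: the `b` pairs first (`posEquiv`), then the `m` blocks
(`blockPos`). [folklore] -/
private def stdLayout (b m p : ℕ) (hd : 2 * b + 2 * (2 * m) = 2 * p) :
    (Fin b × Fin 2) ⊕ (Fin m × Fin 4) → Fin (2 * p) :=
  Sum.elim (fun cr => Fin.cast hd (Fin.castAdd (2 * (2 * m)) (posEquiv b cr)))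
    (fun ki => Fin.cast hd (Fin.natAdd (2 * b) (blockPos m ki.1 ki.2)))

/-- The standard layout is a bijection. [folklore] -/
private theorem stdLayout_bijective (hd : 2 * b + 2 * (2 * m) = 2 * p) :
    Function.Bijective (stdLayout b m p hd) := by
  have h : stdLayout b m p hd = ⇑((Equiv.sumCongr (posEquiv b) (Equiv.ofBijective _ (blockPos_bijective m))).trans
      (finSumFinEquiv.trans (finCongr hd))) := by
    funext x
    rcases x with cr | ⟨k, i⟩
    · simp [stdLayout]
    · simp [stdLayout]
  rw [h]
  exact Equiv.bijective _

/-- The layout of the positions dictated by a basic `SL`-invariant: pair `c` = (its vector position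
`β(inl q_c)`, its covector position `q_c`), block `k` = the vector positions `β(inr (k, ·))`. [folklore] -/
private def betaLayout (eC : {q : Fin (2 * p) // ty q = false} ≃ Fin b) :
    (Fin b × Fin 2) ⊕ (Fin m × Fin 4) → Fin (2 * p) :=
  Sum.elim (fun cr => if cr.2 = 0 then (β (Sum.inl (eC.symm cr.1))).1 else (eC.symm cr.1).1)
    (fun ki => (β (Sum.inr ki)).1)

/-- A vector position is never a covector position. [folklore] -/
private theorem val_ne_val_of_types (v : {q : Fin (2 * p) // ty q = true}) (q : {q : Fin (2 * p) // ty q = false}) :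
    v.1 ≠ q.1 := by
  intro h
  have h1 := v.2
  rw [h, q.2] at h1
  exact Bool.false_ne_true h1

/-- The `β`-layout is a bijection (`β` is a bijection onto the vector positions, the covector positions are the
rest, and `2b + 4m = 2p`). [folklore] -/
private theorem betaLayout_bijective (hd : 2 * b + 2 * (2 * m) = 2 * p)
    (eC : {q : Fin (2 * p) // ty q = false} ≃ Fin b) : Function.Bijective (betaLayout ty β eC) := by
  classical
  rw [Fintype.bijective_iff_injective_and_card]
  refine ⟨?_, by simp [Fintype.card_sum, Fintype.card_prod, Fintype.card_fin]; omega⟩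
  rintro (⟨c, r⟩ | ⟨k, i⟩) (⟨c', r'⟩ | ⟨k', i'⟩) h
  · rcases fin2_cases₃ r with rfl | rfl <;> rcases fin2_cases₃ r' with rfl | rfl
    · simp only [betaLayout, Sum.elim_inl, if_true] at h
      have h2 := Sum.inl_injective (β.injective (Subtype.ext h))
      rw [Equiv.apply_eq_iff_eq] at h2
      rw [h2]
    · simp only [betaLayout, Sum.elim_inl, if_true, Fin.one_eq_zero_iff, OfNat.ofNat_ne_one, if_false] at h
      exact absurd h (val_ne_val_of_types ty _ _)
    · simp only [betaLayout, Sum.elim_inl, if_true, Fin.one_eq_zero_iff, OfNat.ofNat_ne_one, if_false] at h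
      exact absurd h.symm (val_ne_val_of_types ty _ _)
    · simp only [betaLayout, Sum.elim_inl, Fin.one_eq_zero_iff, OfNat.ofNat_ne_one, if_false] at h
      have h2 : eC.symm c = eC.symm c' := Subtype.ext h
      rw [Equiv.apply_eq_iff_eq] at h2
      rw [h2]
  · exfalso
    rcases fin2_cases₃ r with rfl | rfl
    · simp only [betaLayout, Sum.elim_inl, if_true, Sum.elim_inr] at h
      exact Sum.inl_ne_inr (β.injective (Subtype.ext h))
    · simp only [betaLayout, Sum.elim_inl, Fin.one_eq_zero_iff, OfNat.ofNat_ne_one, if_false, Sum.elim_inr] at h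
      exact val_ne_val_of_types ty _ _ h.symm
  · exfalso
    rcases fin2_cases₃ r' with rfl | rfl
    · simp only [betaLayout, Sum.elim_inl, if_true, Sum.elim_inr] at h
      exact Sum.inr_ne_inl (β.injective (Subtype.ext h))
    · simp only [betaLayout, Sum.elim_inl, Fin.one_eq_zero_iff, OfNat.ofNat_ne_one, if_false, Sum.elim_inr] at h
      exact val_ne_val_of_types ty _ _ h
  · simp only [betaLayout, Sum.elim_inr] at h
    rw [Sum.inr_injective (β.injective (Subtype.ext h))]

/-- **The layout permutation** `π` of the `2p` positions: standard position ↦ `β`-dictated position. [folklore] -/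
private def layoutPerm (hd : 2 * b + 2 * (2 * m) = 2 * p) (eC : {q : Fin (2 * p) // ty q = false} ≃ Fin b) :
    Equiv.Perm (Fin (2 * p)) :=
  (Equiv.ofBijective _ (stdLayout_bijective (b := b) (m := m) (p := p) hd)).symm.trans
    (Equiv.ofBijective _ (betaLayout_bijective ty β hd eC))

/-- The layout permutation sends standard positions to `β`-dictated positions. [folklore] -/
private theorem layoutPerm_apply_stdLayout (hd : 2 * b + 2 * (2 * m) = 2 * p)
    (eC : {q : Fin (2 * p) // ty q = false} ≃ Fin b) (x : (Fin b × Fin 2) ⊕ (Fin m × Fin 4)) :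
    layoutPerm ty β hd eC (stdLayout b m p hd x) = betaLayout ty β eC x := by
  simp [layoutPerm]

/-- The inverse layout permutation sends `β`-dictated positions to standard positions. [folklore] -/
private theorem layoutPerm_symm_apply_betaLayout (hd : 2 * b + 2 * (2 * m) = 2 * p)
    (eC : {q : Fin (2 * p) // ty q = false} ≃ Fin b) (x : (Fin b × Fin 2) ⊕ (Fin m × Fin 4)) :
    (layoutPerm ty β hd eC).symm (betaLayout ty β eC x) = stdLayout b m p hd x := by
  rw [Equiv.symm_apply_eq, layoutPerm_apply_stdLayout]

/-- **In the standard layout a basic `SL`-invariant is the external product of the pair-contraction tensor and the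
block tensor.** [cite: GoodmanWallachGTM255, §9.1.4 Exercise 4 (b)] -/
private theorem slBasicTensor_comp_layoutPerm_symm (hd : 2 * b + 2 * (2 * m) = 2 * p)
    (eC : {q : Fin (2 * p) // ty q = false} ≃ Fin b) (ε : Word 4 (2 * p)) :
    slBasicTensor ℂ ty m β (ε ∘ ⇑(layoutPerm ty β hd eC).symm) =
      appendFun ℂ (fun ε₁ : Word 4 (2 * b) =>
          ∏ c : Fin b, if ε₁ (posEquiv b (c, 0)) = ε₁ (posEquiv b (c, 1)) then (1 : ℂ) else 0)
        (fun ε₂ : Word 4 (2 * (2 * m)) => ∏ k : Fin m, detTensor ℂ 4 (fun i => ε₂ (blockPos m k i)))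
        (fun q => ε (Fin.cast hd q)) := by
  classical
  unfold slBasicTensor appendFun
  congr 1
  · refine Fintype.prod_equiv eC _ _ fun q => ?_
    have h0 : (layoutPerm ty β hd eC).symm (β (Sum.inl q)).1 =
        Fin.cast hd (Fin.castAdd (2 * (2 * m)) (posEquiv b (eC q, 0))) := by
      have h := layoutPerm_symm_apply_betaLayout ty β hd eC (Sum.inl (eC q, 0))
      simp only [betaLayout, stdLayout, Sum.elim_inl, if_true, Equiv.symm_apply_apply] at h
      exact h
    have h1 : (layoutPerm ty β hd eC).symm q.1 = Fin.cast hd (Fin.castAdd (2 * (2 * m)) (posEquiv b (eC q, 1))) := by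
      have h := layoutPerm_symm_apply_betaLayout ty β hd eC (Sum.inl (eC q, 1))
      simp only [betaLayout, stdLayout, Sum.elim_inl, Fin.one_eq_zero_iff, OfNat.ofNat_ne_one, if_false,
        Equiv.symm_apply_apply] at h
      exact h
    simp only [Function.comp_apply, h0, h1]
  · refine Finset.prod_congr rfl fun k _ => ?_
    congr 1
    funext i
    have h := layoutPerm_symm_apply_betaLayout ty β hd eC (Sum.inr (k, i))
    simp only [betaLayout, stdLayout, Sum.elim_inr] at h
    simp only [Function.comp_apply, h]

variable {B : AbelianVariety ℂ} {ι' : Type*}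

/-- **Evaluation of a basic `SL`-invariant: contractions give divisor classes, determinant blocks give Weil-type
classes, and the value is algebraic when the blocks are.** For letters `y(U q, ·)` dictated by a slot word `U`, a
typing `ty` with a basic `SL₄`-invariant `β` (`b` contractions, `m` determinant blocks, `2b + 4m = 2p`):
`Σ_ε (slBasicTensor ty m β)(ε) · (y(U q, ε q))_q^{⌣} = sgn(π) · (Σ_λ glPairWord^{⌣}) ⌣ (Ω_{block 1} ⌣ ⋯ ⌣ Ω_{block m})`;
if every crossed class `Σ_ℓ y(U(β q), ℓ) ⌣ y(U q, ℓ)` is in `B¹(B) ⊗ ℂ` and every block class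
`Σ_σ sgn σ · (y(U(β(k,i)), σ i))_i^{⌣}` is algebraic of codimension `2`, the value is an algebraic class of
codimension `p` (Lefschetz `(1,1)` for the divisor part; algebraic classes on an abelian variety are closed under cup
product). Moonen–Zarhin 1995, row «IV(1,1), (2,2)»: `B•(Xⁿ) = ⟨D, W_K⟩`; van Geemen Thm. 6.12; the invariant theory is
Goodman–Wallach §9.1.4 Ex. 4. [cite: MoonenZarhin1995Duke, main theorem (type IV(1,1), (2,2))]
[cite: vanGeemen1994HodgeAV, Thm. 6.12] [cite: GoodmanWallachGTM255, §9.1.4 Exercise 4] [cite: VoisinHodgeII2003, Prop. 9.20]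
[cite: Milne1999LefschetzClasses, Prop. 3.6 (c)] -/
theorem sum_slBasicTensor_smul_cupPowOne_mem_algebraicClasses (hd : 2 * b + 2 * (2 * m) = 2 * p)
    (eC : {q : Fin (2 * p) // ty q = false} ≃ Fin b) (y : ι' × Fin 4 → complexBetti B.X 1)
    (U : Fin (2 * p) → ι')
    (hpair : ∀ q : {q : Fin (2 * p) // ty q = false},
      (∑ ℓ : Fin 4, cupProduct (rfl : 1 + 1 = 2) (y (U (β (Sum.inl q)).1, ℓ)) (y (U q.1, ℓ))) ∈
        Submodule.span ℂ {x : complexBetti B.X 2 | IsRationalClass x ∧ IsOfHodgeType B.dim B.X 2 1 1 x})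
    (hblock : ∀ k : Fin m, (∑ σ : Equiv.Perm (Fin 4), (((Equiv.Perm.sign σ : ℤˣ) : ℤ) : ℂ) •
      cupPowOne ℂ (Motives.ComplexPoints B.X) 4 (fun i => y (U (β (Sum.inr (k, i))).1, σ i))) ∈
        algebraicClasses B.X 2) :
    (∑ ε : Word 4 (2 * p), slBasicTensor ℂ ty m β ε •
      cupPowOne ℂ (Motives.ComplexPoints B.X) (2 * p) (fun q => y (U q, ε q))) ∈ algebraicClasses B.X p := by
  classical
  have hX : IsSmoothProjective B.dim B.X := AbelianVariety.isSmoothProjective_holds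
  set π := layoutPerm ty β hd eC with hπ
  -- reorder the positions along `π`
  have hperm := sum_smul_eq_sign_smul_sum_comp_perm (cupPowOneAlt ℂ (Motives.ComplexPoints B.X) (2 * p))
    (slBasicTensor ℂ ty m β) (fun q ℓ => y (U q, ℓ)) π
  simp only [cupPowOneAlt_apply] at hperm
  rw [hperm]
  refine Submodule.smul_mem _ _ ?_
  simp_rw [hπ, slBasicTensor_comp_layoutPerm_symm ty β hd eC]
  rw [sum_appendFun_smul_cupPowOne hd _ _ (fun q ℓ => y (U (layoutPerm ty β hd eC q), ℓ))]
  refine AbelianVariety.cupProduct_mem_algebraicClasses' B hd ?_ ?_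
  · -- the contraction part: divisor classes
    refine AbelianVariety.divisorClassesSpan_le_algebraicClasses B
      (fun x hx hxx => lefschetzOneOne_rational_holds hX x hx hxx) b ?_
    have hword : ∀ (ε₁ : Word 4 (2 * b)) (i : Fin (2 * b)),
        y (U (layoutPerm ty β hd eC (Fin.cast hd (Fin.castAdd (2 * (2 * m)) i))), ε₁ i) =
          y (if ((posEquiv b).symm i).2 = 0 then U (β (Sum.inl (eC.symm ((posEquiv b).symm i).1))).1
            else U (eC.symm ((posEquiv b).symm i).1).1, ε₁ i) := by
      intro ε₁ i
      obtain ⟨⟨c, r⟩, rfl⟩ := (posEquiv b).surjective i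
      have h := layoutPerm_apply_stdLayout ty β hd eC (Sum.inl (c, r))
      simp only [stdLayout, Sum.elim_inl, betaLayout] at h
      rw [h, Equiv.symm_apply_apply]
      rcases fin2_cases₃ r with rfl | rfl
      · simp
      · simp
    simp_rw [hword]
    exact sum_pairTensor_smul_cupPowOne_mem_divisorClassesSpan y (fun c => U (β (Sum.inl (eC.symm c))).1)
      (fun c => U (eC.symm c).1) fun c => hpair (eC.symm c)
  · -- the determinant blocks: products of Weil-type classes
    refine sum_blockTensor_smul_cupPowOne_mem_algebraicClasses m
      (fun j ℓ => y (U (layoutPerm ty β hd eC (Fin.cast hd (Fin.natAdd (2 * b) j))), ℓ)) fun k => ?_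
    have hword : ∀ i : Fin 4, U (layoutPerm ty β hd eC (Fin.cast hd (Fin.natAdd (2 * b) (blockPos m k i)))) =
        U (β (Sum.inr (k, i))).1 := by
      intro i
      have h := layoutPerm_apply_stdLayout ty β hd eC (Sum.inr (k, i))
      simp only [stdLayout, Sum.elim_inr, betaLayout] at h
      rw [h]
    simp_rw [hword]
    exact hblock k

end Layout

/-! ### §4 All Hodge classes on `B` with slots over a fourfold of unitary type `(2,2)` -/

section Assembly

variable {A B : AbelianVariety ℂ} {n : ℕ} {g : Fin n → (B ⟶ A)}

/-- The cardinalities of the two position types add up. [folklore] -/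
private theorem card_true_add_card_false {D : ℕ} (ty : Fin D → Bool) :
    Fintype.card {q : Fin D // ty q = true} + Fintype.card {q : Fin D // ty q = false} = D := by
  classical
  rw [Fintype.card_subtype, Fintype.card_subtype]
  have h := Finset.card_filter_add_card_filter_not (s := (Finset.univ : Finset (Fin D))) (fun t => ty t = true)
  simp only [Bool.not_eq_true, Finset.card_univ, Fintype.card_fin] at h
  exact h

open scoped Classical in
/-- **Every Hodge class, of every codimension, on an abelian variety `B` with slots over a fourfold `A` of unitary type
`(2,2)` is algebraic as soon as the Weil-type classes `Ω_t(j)` are** (Moonen–Zarhin 1995, row «IV(1,1), (2,2)»: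
`B•(Xⁿ) = ⟨D, W_K⟩` — here the inclusion `⊆`, for every `B` with slots over `A`, in every codimension, read through
«algebraic»). Data as in `AVSlots.codimTwoHodgeClasses_divisorWeil_twoTwo` (`n₀ = 4` letters), plus the crossed
classes in both orders (`hcross`, `hcross'`) and `hΩ`: every Weil-type class
`Ω_t(j) = Σ_{σ ∈ 𝔖₄} sgn σ · (g_{j 0}^* cb(t, σ 0) ⌣ ⋯ ⌣ g_{j 3}^* cb(t, σ 3))` is algebraic. Proof: the invariance
theorem (`AVSlots.exists_unitaryInvariant_coeff_twoTwo`) writes a rational `(p,p)`-class as `Σ_w a(w) (g e, g f)_w`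
with `𝔰𝔩₄`-invariant slices; the tensor FFT for `SL₄` (`mem_span_slBasicTensor_of_forall_trace`, resp. its flip for
slices with more covector than vector positions) makes every slice a combination of basic invariants
`slBasicTensor ty m β`, each of which evaluates (§3) to `±` (a product of crossed classes, in `D^b`) `⌣` (a product of
`m` classes `Ω_t(j)`), an algebraic class. [cite: MoonenZarhin1995Duke, main theorem (type IV(1,1), (2,2))]
[cite: vanGeemen1994HodgeAV, Thm. 6.11 and Thm. 6.12] [cite: MoonenZarhin1999LowDim, §2 (2.5) (2)]
[cite: GoodmanWallachGTM255, §9.1.4 Exercise 4] [cite: Milne1999LefschetzClasses, Prop. 3.6 (c)] -/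
theorem AVSlots.hodgeClasses_algebraic_of_weilClasses_twoTwo [HodgeTensorFacts.{0, 0}] (hg : AVSlots A B g)
    (hHD : exists_isReal_hodgeModel) (hI : hodgePQ_independent_of_hodgeModel)
    (ψ : (BettiUniverse.hodge hHD (AbelianVariety.isSmoothProjective_holds (A := A)) 1).Polarization)
    {φ : Module.End ℚ (bettiCohomology A.X 1)}
    (hφE : φ ∈ (BettiUniverse.hodge hHD (AbelianVariety.isSmoothProjective_holds (A := A)) 1).endAlg)
    {d : ℚ} (hd : 0 < d) (hφ2 : φ * φ = -(d • 1))
    (hE : ∀ a ∈ (BettiUniverse.hodge hHD (AbelianVariety.isSmoothProjective_holds (A := A)) 1).endAlg,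
      ∃ x y : ℚ, a = x • 1 + y • φ)
    {μ : ℂ} (hμ : μ ^ 2 = -(d : ℂ))
    (h22 : Module.finrank ℂ ↥(Module.End.eigenspace (φ.baseChange ℂ) μ ⊓
        (BettiUniverse.hodge hHD (AbelianVariety.isSmoothProjective_holds (A := A)) 1).piece 1 0) = 2 ∧
      Module.finrank ℂ ↥(Module.End.eigenspace (φ.baseChange ℂ) μ ⊓
        (BettiUniverse.hodge hHD (AbelianVariety.isSmoothProjective_holds (A := A)) 1).piece 0 1) = 2)
    (cb : Module.Basis (Fin 2 × Fin 4) ℂ (ℂ ⊗[ℚ] bettiCohomology A.X 1)) (κ : Fin 4 → Fin 2)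
    (hcbW : ∀ ℓ, cb (0, ℓ) ∈ Module.End.eigenspace (φ.baseChange ℂ) μ)
    (hcbW' : ∀ ℓ, cb (1, ℓ) ∈ Module.End.eigenspace (φ.baseChange ℂ) (-μ))
    (hcb0 : ∀ ℓ, κ ℓ = 0 →
      cb (0, ℓ) ∈ (BettiUniverse.hodge hHD (AbelianVariety.isSmoothProjective_holds (A := A)) 1).piece 1 0 ∧
      cb (1, ℓ) ∈ (BettiUniverse.hodge hHD (AbelianVariety.isSmoothProjective_holds (A := A)) 1).piece 0 1)
    (hcb1 : ∀ ℓ, κ ℓ = 1 →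
      cb (0, ℓ) ∈ (BettiUniverse.hodge hHD (AbelianVariety.isSmoothProjective_holds (A := A)) 1).piece 0 1 ∧
      cb (1, ℓ) ∈ (BettiUniverse.hodge hHD (AbelianVariety.isSmoothProjective_holds (A := A)) 1).piece 1 0)
    (hdual : ∀ i j, ψ.form.baseChange ℂ (cb (0, i)) (cb (1, j)) = if i = j then 1 else 0)
    (hcross : ∀ j j' : Fin n,
      (∑ ℓ : Fin 4, cupProduct (rfl : 1 + 1 = 2)
          (avLetters g (fun tl : Fin 2 × Fin 4 => ofRatClassBaseChange (Motives.ComplexPoints A.X) 1 (cb tl))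
            (j, ((0 : Fin 2), ℓ)))
          (avLetters g (fun tl : Fin 2 × Fin 4 => ofRatClassBaseChange (Motives.ComplexPoints A.X) 1 (cb tl))
            (j', ((1 : Fin 2), ℓ)))) ∈
        Submodule.span ℂ {b : complexBetti B.X 2 | IsRationalClass b ∧ IsOfHodgeType B.dim B.X 2 1 1 b})
    (hcross' : ∀ j j' : Fin n,
      (∑ ℓ : Fin 4, cupProduct (rfl : 1 + 1 = 2)
          (avLetters g (fun tl : Fin 2 × Fin 4 => ofRatClassBaseChange (Motives.ComplexPoints A.X) 1 (cb tl))
            (j, ((1 : Fin 2), ℓ)))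
          (avLetters g (fun tl : Fin 2 × Fin 4 => ofRatClassBaseChange (Motives.ComplexPoints A.X) 1 (cb tl))
            (j', ((0 : Fin 2), ℓ)))) ∈
        Submodule.span ℂ {b : complexBetti B.X 2 | IsRationalClass b ∧ IsOfHodgeType B.dim B.X 2 1 1 b})
    (hΩ : ∀ (j : Fin 4 → Fin n) (t : Fin 2),
      (∑ σ : Equiv.Perm (Fin 4), (((Equiv.Perm.sign σ : ℤˣ) : ℤ) : ℂ) •
        cupPowOne ℂ (Motives.ComplexPoints B.X) 4 (fun q =>
          avLetters g (fun tl : Fin 2 × Fin 4 => ofRatClassBaseChange (Motives.ComplexPoints A.X) 1 (cb tl))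
            (j q, (t, σ q)))) ∈ algebraicClasses B.X 2)
    {p : ℕ} {c : complexBetti B.X (2 * p)} (hcQ : IsRationalClass c) (hc : IsOfHodgeType B.dim B.X (2 * p) p p c) :
    c ∈ algebraicClasses B.X p := by
  classical
  rcases Nat.eq_zero_or_pos p with rfl | hp
  · exact hodgeConjectureFor_codim_zero c
  obtain ⟨a, hca, hkill⟩ := hg.exists_unitaryInvariant_coeff_twoTwo hHD hI ψ hφE hd hφ2 hE hμ h22 cb κ hcbW hcbW'
    hcb0 hcb1 hdual hp hcQ hc
  set y : (Fin n × Fin 2) × Fin 4 → complexBetti B.X 1 := fun x =>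
    avLetters g (fun tl : Fin 2 × Fin 4 => ofRatClassBaseChange (Motives.ComplexPoints A.X) 1 (cb tl))
      (x.1.1, (x.1.2, x.2)) with hy
  have hyU : ∀ (jt : Fin n × Fin 2) (ℓ : Fin 4), y (jt, ℓ) = avLetters g (fun tl : Fin 2 × Fin 4 =>
      ofRatClassBaseChange (Motives.ComplexPoints A.X) 1 (cb tl)) (jt.1, (jt.2, ℓ)) := fun jt ℓ => rfl
  set F := cupPowOneAlt ℂ (Motives.ComplexPoints B.X) (2 * p) with hFdef
  rw [← hca, wordEval_eq_sum_wordSlice]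
  refine Submodule.sum_mem _ fun U _ => ?_
  -- the slice at the slot-and-type word `U`, its typing, and its `𝔰𝔩₄`-invariance
  set ty : Fin (2 * p) → Bool := fun t => decide ((U t).2 = 0) with hty
  have hkillU : ∀ X : Matrix (Fin 4) (Fin 4) ℂ, X.trace = 0 →
      wordDerAt ℂ (mixedLieFamily ty X) (wordSlice a U) = 0 := by
    intro X hX
    have hfam : mixedLieFamily ty X = fun t => if (U t).2 = 0 then X else -Xᵀ := by
      funext t
      simp only [hty, mixedLieFamily, decide_eq_true_eq]
    rw [hfam]
    exact hkill U X hX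
  have htrue : ∀ q : Fin (2 * p), ty q = true → (U q).2 = 0 := fun q h => by
    simpa only [hty, decide_eq_true_eq] using h
  have hfalse : ∀ q : Fin (2 * p), ty q = false → (U q).2 = 1 := fun q h => by
    simp only [hty, decide_eq_false_iff_not] at h
    rcases fin2_cases₃ (U q).2 with h' | h'
    · exact absurd h' h
    · exact h'
  -- the evaluation functional on coefficient functions of colour words
  set Λ := Fintype.linearCombination ℂ (fun ε : Word 4 (2 * p) => F (fun q => y (U q, ε q))) with hΛ
  have hΛapply : ∀ cf : Word 4 (2 * p) → ℂ, Λ cf = ∑ ε, cf ε • F (fun q => y (U q, ε q)) :=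
    fun cf => Fintype.linearCombination_apply ℂ _ cf
  rw [← hΛapply]
  -- the value of every basic `SL₄`-invariant (for any typing `ty'` with constant slot types) is algebraic
  have heval : ∀ (ty' : Fin (2 * p) → Bool) (t₀ t₁ : Fin 2), (∀ q, ty' q = true → (U q).2 = t₀) →
      (∀ q, ty' q = false → (U q).2 = t₁) →
      (∀ j j' : Fin n, (∑ ℓ : Fin 4, cupProduct (rfl : 1 + 1 = 2)
          (avLetters g (fun tl : Fin 2 × Fin 4 => ofRatClassBaseChange (Motives.ComplexPoints A.X) 1 (cb tl))
            (j, (t₀, ℓ)))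
          (avLetters g (fun tl : Fin 2 × Fin 4 => ofRatClassBaseChange (Motives.ComplexPoints A.X) 1 (cb tl))
            (j', (t₁, ℓ)))) ∈
        Submodule.span ℂ {b : complexBetti B.X 2 | IsRationalClass b ∧ IsOfHodgeType B.dim B.X 2 1 1 b}) →
      ∀ (m : ℕ) (β : ({q : Fin (2 * p) // ty' q = false} ⊕ (Fin m × Fin 4)) ≃ {q : Fin (2 * p) // ty' q = true}),
        Λ (slBasicTensor ℂ ty' m β) ∈ algebraicClasses B.X p := by
    intro ty' t₀ t₁ ht₀ ht₁ hcr m β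
    -- the counts: `#vec = #cov + 4m`, `#vec + #cov = 2p`
    have hβ := Fintype.card_congr β
    rw [Fintype.card_sum, Fintype.card_prod, Fintype.card_fin, Fintype.card_fin] at hβ
    have htot := card_true_add_card_false ty'
    set b := Fintype.card {q : Fin (2 * p) // ty' q = false} with hb
    have hd' : 2 * b + 2 * (2 * m) = 2 * p := by omega
    rw [hΛapply]
    simp only [hFdef, cupPowOneAlt_apply]
    refine sum_slBasicTensor_smul_cupPowOne_mem_algebraicClasses ty' β hd' (Fintype.equivFin _) y U
      (fun q => ?_) (fun k => ?_)
    · simp only [hyU, ht₀ _ (β (Sum.inl q)).2, ht₁ _ q.2]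
      exact hcr _ _
    · simp only [hyU, ht₀ _ (β (Sum.inr (k, _))).2]
      exact hΩ (fun i => (U (β (Sum.inr (k, i))).1).1) t₀
  by_cases hle : (Finset.univ.filter fun t => ty t = false).card ≤ (Finset.univ.filter fun t => ty t = true).card
  · -- at least as many `W`-positions as `W'`-positions: basic invariants for `ty`
    have hmem := mem_span_slBasicTensor_of_forall_trace ty hkillU hle
    refine (Submodule.span_le (p := (algebraicClasses B.X p).comap Λ)).2 ?_ hmem
    rintro _ ⟨m, β, rfl⟩
    rw [SetLike.mem_coe, Submodule.mem_comap]
    exact heval ty 0 1 htrue hfalse hcross m β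
  · -- more `W'`-positions: basic invariants for the flipped typing
    have hle' : (Finset.univ.filter fun t => ty t = true).card ≤
        (Finset.univ.filter fun t => ty t = false).card := le_of_not_ge hle
    have hmem := mem_span_slBasicTensor_not_of_forall_trace ty hkillU hle'
    refine (Submodule.span_le (p := (algebraicClasses B.X p).comap Λ)).2 ?_ hmem
    rintro _ ⟨m, β, rfl⟩
    rw [SetLike.mem_coe, Submodule.mem_comap]
    refine heval (fun q => !ty q) 1 0 (fun q h => hfalse q ?_) (fun q h => htrue q ?_) hcross' m β
    · simpa using h
    · simpa using h

end Assembly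

/-! ### §5 Polarization: the Weil-type classes of the slots are pullbacks of the Weil classes of `A` -/

section Polarization

variable {A B : AbelianVariety ℂ} {N : ℕ}

/-- **Inclusion–exclusion**: `Σ_{S ⊇ R} (−1)^{N − #S} = [R = everything]`. [folklore] -/
private theorem sum_ite_subset_neg_one_pow (R : Finset (Fin N)) :
    (∑ S : Finset (Fin N), if R ⊆ S then (-1 : ℂ) ^ (N - S.card) else 0) =
      if R = Finset.univ then 1 else 0 := by
  classical
  rw [← Finset.sum_filter]
  have hset : (Finset.univ.filter fun S : Finset (Fin N) => R ⊆ S) =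
      (Rᶜ).powerset.map ⟨compl, compl_injective⟩ := by
    ext S
    simp only [Finset.mem_filter, Finset.mem_univ, true_and, Finset.mem_map, Finset.mem_powerset,
      Function.Embedding.coeFn_mk]
    constructor
    · intro h
      exact ⟨Sᶜ, Finset.compl_subset_compl.2 h, compl_compl S⟩
    · rintro ⟨T, hT, rfl⟩
      rwa [← Finset.compl_subset_compl, compl_compl]
  rw [hset, Finset.sum_map]
  simp only [Function.Embedding.coeFn_mk]
  have hcard : ∀ T : Finset (Fin N), N - Tᶜ.card = T.card := fun T => by
    rw [Finset.card_compl, Fintype.card_fin]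
    have := T.card_le_univ
    rw [Fintype.card_fin] at this
    omega
  simp_rw [hcard]
  have h := Finset.sum_powerset_neg_one_pow_card (x := Rᶜ)
  have h' : (∑ T ∈ (Rᶜ).powerset, (-1 : ℂ) ^ T.card) = (((∑ T ∈ (Rᶜ).powerset, (-1 : ℤ) ^ T.card) : ℤ) : ℂ) := by
    push_cast
    rfl
  rw [h', h]
  simp only [Finset.compl_eq_empty_iff]
  split_ifs <;> simp

/-- A word `Fin N → Fin N` whose image is everything is a bijection. [folklore] -/
private theorem bijective_of_image_eq_univ {r : Fin N → Fin N} (h : Finset.univ.image r = Finset.univ) :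
    Function.Bijective r := by
  classical
  have hs : Function.Surjective r := fun i => by
    have hi : i ∈ Finset.univ.image r := by rw [h]; exact Finset.mem_univ i
    obtain ⟨j, -, hj⟩ := Finset.mem_image.1 hi
    exact ⟨j, hj⟩
  exact ⟨Finite.injective_iff_surjective.2 hs, hs⟩

/-- **Polarization of the antisymmetrised pullback product.** For homomorphisms `f_0, …, f_{N−1} : B → A`, degree-one
classes `e_0, …, e_{N−1}` on `A`, and homomorphisms `f_S` acting on `H¹` as `Σ_{s ∈ S} f_s^*` (e.g. `f_S = Σ_{s∈S} f_s`):
`Σ_{σ ∈ 𝔖_N} sgn σ · (f_0^* e_{σ 0} ⌣ ⋯ ⌣ f_{N−1}^* e_{σ(N−1)}) = Σ_{S ⊆ {0,…,N−1}} (−1)^{N−#S} f_S^*(e_0 ⌣ ⋯ ⌣ e_{N−1})`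
(`f_S^*` is a ring homomorphism, the cup product is multilinear, inclusion–exclusion keeps the surjective slot
assignments, and `F(v ∘ τ) = sgn τ · F(v)`). This is how the Weil classes of the powers `Xⁿ` arise from `W_K(X)` in
Moonen–Zarhin's `B•(Xⁿ) = ⟨D, W_K⟩`. [cite: MoonenZarhin1995Duke, main theorem (type IV(1,1), (2,2))]
[cite: vanGeemen1994HodgeAV, 4.8 and 4.9] [cite: Hatcher2002, Prop. 3.10] -/
theorem sum_sign_smul_cupPowOne_map_eq_sum_powerset (f : Fin N → (B ⟶ A)) (e : Fin N → complexBetti A.X 1)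
    (fS : Finset (Fin N) → (B ⟶ A))
    (hfS : ∀ (S : Finset (Fin N)) (x : complexBetti A.X 1),
      complexBetti.map (fS S).hom.hom.hom 1 x = ∑ s ∈ S, complexBetti.map (f s).hom.hom.hom 1 x) :
    (∑ σ : Equiv.Perm (Fin N), (((Equiv.Perm.sign σ : ℤˣ) : ℤ) : ℂ) •
        cupPowOne ℂ (Motives.ComplexPoints B.X) N (fun i => complexBetti.map (f i).hom.hom.hom 1 (e (σ i)))) =
      ∑ S : Finset (Fin N), ((-1 : ℂ) ^ (N - S.card)) •
        complexBetti.map (fS S).hom.hom.hom N (cupPowOne ℂ (Motives.ComplexPoints B.X |> fun _ =>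
          Motives.ComplexPoints A.X) N e) := by
  classical
  -- the summands `T r = f_{r 0}^* e_0 ⌣ ⋯ ⌣ f_{r(N-1)}^* e_{N-1}` for slot assignments `r`
  set T : (Fin N → Fin N) → complexBetti B.X N := fun r =>
    cupPowOne ℂ (Motives.ComplexPoints B.X) N (fun i => complexBetti.map (f (r i)).hom.hom.hom 1 (e i)) with hT
  -- the right-hand side, expanded by multilinearity
  have hR : ∀ S : Finset (Fin N), complexBetti.map (fS S).hom.hom.hom N
      (cupPowOne ℂ (Motives.ComplexPoints A.X) N e) = ∑ r : Fin N → Fin N, (if ∀ i, r i ∈ S then (1 : ℂ) else 0) • T r := by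
    intro S
    rw [Motives.complexBetti_map_cupPowOne]
    simp_rw [hfS S]
    have h := (cupPowOneAlt ℂ (Motives.ComplexPoints B.X) N).toMultilinearMap.map_sum_finset
      (fun i s => complexBetti.map (f s).hom.hom.hom 1 (e i)) (fun _ => S)
    simp only [AlternatingMap.coe_multilinearMap, cupPowOneAlt_apply] at h
    rw [h]
    have hset : (Fintype.piFinset fun _ : Fin N => S) =
        Finset.univ.filter (fun r : Fin N → Fin N => ∀ i, r i ∈ S) := by
      ext r
      simp [Fintype.mem_piFinset]
    rw [hset, Finset.sum_filter]
    refine Finset.sum_congr rfl fun r _ => ?_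
    split_ifs
    · rw [one_smul]
    · rw [zero_smul]
  simp_rw [hR, Finset.smul_sum, smul_smul, mul_ite, mul_one, mul_zero]
  rw [Finset.sum_comm]
  simp_rw [← Finset.sum_smul]
  -- inclusion–exclusion: only the surjective slot assignments survive
  have hIE : ∀ r : Fin N → Fin N, (∑ S : Finset (Fin N), if ∀ i, r i ∈ S then (-1 : ℂ) ^ (N - S.card) else 0) =
      if Finset.univ.image r = Finset.univ then 1 else 0 := by
    intro r
    rw [← sum_ite_subset_neg_one_pow (Finset.univ.image r)]
    refine Finset.sum_congr rfl fun S _ => ?_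
    have hiff : (∀ i, r i ∈ S) ↔ Finset.univ.image r ⊆ S := by
      rw [Finset.image_subset_iff]
      simp
    simp only [hiff]
  simp_rw [hIE, ite_smul, one_smul, zero_smul]
  rw [show (∑ r : Fin N → Fin N, if Finset.univ.image r = Finset.univ then T r else 0) =
      ∑ τ : Equiv.Perm (Fin N), T ⇑τ from by
    rw [sum_word_eq_sum_perm' (fun r : Fin N → Fin N => if Finset.univ.image r = Finset.univ then T r else 0)
      (fun r hr => if_neg fun h => hr (bijective_of_image_eq_univ h))]
    refine Finset.sum_congr rfl fun τ _ => if_pos ?_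
    exact Finset.eq_univ_of_forall fun i => Finset.mem_image.2 ⟨τ.symm i, Finset.mem_univ _, τ.apply_symm_apply i⟩]
  -- the left-hand side: `T τ = sgn τ · F(i ↦ f_i^* e_{τ⁻¹ i})`, then `τ ↦ τ⁻¹`
  have hL : ∀ τ : Equiv.Perm (Fin N), T ⇑τ = (((Equiv.Perm.sign τ : ℤˣ) : ℤ) : ℂ) •
      cupPowOne ℂ (Motives.ComplexPoints B.X) N (fun i => complexBetti.map (f i).hom.hom.hom 1 (e (τ.symm i))) := by
    intro τ
    have h := (cupPowOneAlt ℂ (Motives.ComplexPoints B.X) N).map_perm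
      (fun i => complexBetti.map (f i).hom.hom.hom 1 (e (τ.symm i))) τ
    rw [units_smul_eq_cast_smul (K := ℂ)] at h
    simp only [cupPowOneAlt_apply] at h
    rw [← h]
    simp only [hT, Function.comp_def, Equiv.symm_apply_apply]
  simp_rw [hL]
  refine Fintype.sum_equiv (Equiv.inv (Equiv.Perm (Fin N))) _ _ fun σ => ?_
  simp only [Equiv.inv_apply, Equiv.Perm.sign_inv]
  rfl

end Polarization

/-! ### §6 The geometric theorems: all powers of a fourfold of unitary type `(2,2)` -/

section Geometric

variable {A B : AbelianVariety ℂ} {n : ℕ} {g : Fin n → (B ⟶ A)}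

/-- Pullback along a finite sum of homomorphisms is the sum of the pullbacks on `H¹`. [cite: LangeBirkenhake1992, §1.1 (p. 19)] -/
private theorem complexBetti_map_finset_sum_one_apply {ι : Type*} (S : Finset ι) (f : ι → (B ⟶ A))
    (x : complexBetti A.X 1) :
    complexBetti.map (∑ s ∈ S, f s).hom.hom.hom 1 x = ∑ s ∈ S, complexBetti.map (f s).hom.hom.hom 1 x := by
  classical
  induction S using Finset.induction_on with
  | empty =>
    rw [Finset.sum_empty, Finset.sum_empty, complexBetti_map_zero_one]
    rfl
  | insert a S ha ih =>
    rw [Finset.sum_insert ha, Finset.sum_insert ha, complexBetti_map_add_one, ← ih]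
    rfl

/-- **The Weil-type classes of the slots are algebraic when the Weil classes `W_K(A)` are.** For letters
`L(0,·) ⊂ W`, `L(1,·) ⊂ W'` (eigenclasses of `φ^*` for `± i√d`) and slots `g_j : B → A`:
`Ω_t(j) = Σ_σ sgn σ · (g_{j 0}^* L(t,σ 0) ⌣ ⋯ ⌣ g_{j 3}^* L(t,σ 3)) = Σ_S (−1)^{4−#S} (Σ_{s∈S} g_{j s})^* (L(t,0) ⌣ ⋯ ⌣ L(t,3))`
(§5) with `L(t,0) ⌣ ⋯ ⌣ L(t,3) ∈ E_± ⊆ W_K ⊗ ℂ`; pullbacks of algebraic classes along homomorphisms of abelian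
varieties are algebraic. [cite: MoonenZarhin1995Duke, main theorem (type IV(1,1), (2,2))]
[cite: vanGeemen1994HodgeAV, 4.9 and proof of Thm. 6.12] -/
theorem sum_sign_smul_cupPowOne_avLetters_mem_algebraicClasses_of_weilClassesOf (g : Fin n → (B ⟶ A)) (φ : A ⟶ A)
    {d : ℕ} (L : Fin 2 × Fin 4 → complexBetti A.X 1)
    (hL0 : ∀ ℓ, VanGeemen1994.pullbackOne A φ (L (0, ℓ)) = (Complex.I * (Real.sqrt d : ℂ)) • L (0, ℓ))
    (hL1 : ∀ ℓ, VanGeemen1994.pullbackOne A φ (L (1, ℓ)) = (-(Complex.I * (Real.sqrt d : ℂ))) • L (1, ℓ))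
    (hW : weilClassesOf A φ 2 d ≤ algebraicClasses A.X 2) (j : Fin 4 → Fin n) (t : Fin 2) :
    (∑ σ : Equiv.Perm (Fin 4), (((Equiv.Perm.sign σ : ℤˣ) : ℤ) : ℂ) •
      cupPowOne ℂ (Motives.ComplexPoints B.X) 4 (fun q => avLetters g L (j q, (t, σ q)))) ∈ algebraicClasses B.X 2 := by
  classical
  have hB : IsSmoothProjective B.dim B.X := AbelianVariety.isSmoothProjective_holds
  simp only [avLetters_apply]
  rw [sum_sign_smul_cupPowOne_map_eq_sum_powerset (fun q => g (j q)) (fun ℓ => L (t, ℓ))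
    (fun S => ∑ s ∈ S, g (j s)) (fun S x => complexBetti_map_finset_sum_one_apply S (fun s => g (j s)) x)]
  refine Submodule.sum_mem _ fun S _ => Submodule.smul_mem _ _ ?_
  refine map_mem_algebraicClasses_of_abelianVariety hB A _ (p := 2) (hW ?_)
  rcases fin2_cases₃ t with rfl | rfl
  · exact weilClassesPlus_le_weilClassesOf A φ 2 d
      (cupPowOne_mem_weilClassesPlus (n := 2) fun q => Module.End.mem_eigenspace_iff.2 (hL0 q))
  · exact weilClassesMinus_le_weilClassesOf A φ 2 d
      (cupPowOne_mem_weilClassesMinus (n := 2) fun q => Module.End.mem_eigenspace_iff.2 (hL1 q))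

/-- **THE HODGE CONJECTURE FOR EVERY ABELIAN VARIETY WITH SLOTS OVER A FOURFOLD OF UNITARY TYPE `(2,2)` — in
particular for all powers `Aⁿ` — GRANTED the algebraicity of the Weil classes `W_K(A)` of `A` alone.** Hypotheses on
`A`: `φ ≫ φ = −d` (`d > 0`), `finrank_ℚ End⁰(A) = 2`, `dim A = 4`, both multiplicities of `φ` at `± i√d` at least `2`;
on `B`: slots `g : Fin n → (B ⟶ A)` (`AVSlots`); and `hWalg`: every rational `(2,2)` Weil class of `(A, φ)` is
algebraic. Conclusion: `HodgeConjectureFor B.dim B.X`. Moonen–Zarhin 1995, row «IV(1,1), (2,2)», `B•(Xⁿ) = ⟨D, W_K⟩`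
(«for X of type IV(1,1) with multiplicities (2,2) the Hodge ring of every power is generated by divisors and the Weil
classes») read through algebraicity: §4 with the data assembled as in
`AVSlots.codimTwoHodgeClasses_divisorWeil_of_unitaryTwoTwo` (polarization, `φ^*_ℚ`, adapted dual bases, crossed classes
in both orders are divisor classes), and §6's reduction of the Weil-type classes of the slots to `W_K(A)`.
[cite: MoonenZarhin1995Duke, main theorem (type IV(1,1), (2,2))] [cite: vanGeemen1994HodgeAV, Thm. 6.12 and 4.9]
[cite: MoonenZarhin1999LowDim, §2 (2.4) and (2.5) (2)] [cite: Milne1999LefschetzClasses, Prop. 3.3 and Prop. 3.6 (c)] -/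
theorem AVSlots.hodgeConjectureFor_of_unitaryTwoTwo_of_weilClasses (hg : AVSlots A B g) (φ : A ⟶ A) {d : ℕ}
    (hd : 0 < d) (hφ : φ ≫ φ = -(d • 𝟙 A)) (hE2 : Module.finrank ℚ A.endAlgebra = 2)
    (h2a : 2 ≤ eigenMultiplicity A φ (Complex.I * (Real.sqrt d : ℂ)))
    (h2b : 2 ≤ eigenMultiplicity A φ (-(Complex.I * (Real.sqrt d : ℂ)))) (hdim : A.dim = 4)
    (hWalg : ∀ c ∈ weilClassesOf A φ 2 d, IsRationalClass c → IsOfHodgeType (2 * 2) A.X (2 * 2) 2 2 c →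
      c ∈ algebraicClasses A.X 2) :
    HodgeConjectureFor B.dim B.X := by
  classical
  have hHD : exists_isReal_hodgeModel := exists_isReal_hodgeModel_holds
  have hI : hodgePQ_independent_of_hodgeModel := hodgePQ_independent_of_hodgeModel_holds
  haveI : HodgeTensorFacts.{0, 0} := hodgeTensorFacts_holds.{0, 0}
  haveI : Module.Finite ℚ (bettiCohomology A.X 1) := finite_bettiCohomology_one A
  have hX : IsSmoothProjective A.dim A.X := AbelianVariety.isSmoothProjective_holds
  have hB : IsSmoothProjective B.dim B.X := AbelianVariety.isSmoothProjective_holds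
  refine ⟨nonempty_hodgeModel_holds hB, fun p c hcQ hc => ?_⟩
  -- the Weil plane of `A` is algebraic
  have hWT : IsWeilType A φ 2 d := isWeilType_two_of_eigenMultiplicity_eq_two A φ hd hφ hdim
    (eigenMultiplicity_eq_two_of_two_le A φ hd hφ hdim h2a h2b).1
  have hW : weilClassesOf A φ 2 d ≤ algebraicClasses A.X 2 := hWT.weilClassesOf_le_algebraicClasses hWalg
  -- a polarization of `H¹(A(ℂ); ℚ)`
  obtain ⟨ψ⟩ : (BettiUniverse.hodge hHD (AbelianVariety.isSmoothProjective_holds (A := A)) 1).IsPolarizable :=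
    smoothProjective_hodgeStructure_isPolarizable_holds hX (BettiUniverse.realHodgeModel hHD hX)
      (BettiUniverse.realHodgeModel_isHodgeSymmetric hHD hX) 1
  have heff := BettiUniverse.hodge_isEffective hHD hX 1
  -- the rational datum `φ^*_ℚ`
  set φQ : Module.End ℚ (bettiCohomology A.X 1) := (bettiCohomology.map φ.hom.hom.hom 1).hom with hφQ
  have hφE : φQ ∈ (BettiUniverse.hodge hHD (AbelianVariety.isSmoothProjective_holds (A := A)) 1).endAlg := by
    have h := unop_bettiRep_mem_endAlg hHD hI (AbelianVariety.endAlgebra.of A φ)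
    rwa [Literature.AlgebraicGeometry.ComplexMultiplication.bettiRep_of, MulOpposite.unop_op] at h
  have hφ2 : φQ * φQ = -((d : ℚ) • 1) := bettiMapHom_mul_self hφ
  have hdQ : (0 : ℚ) < d := Nat.cast_pos.2 hd
  have hE := exists_eq_smul_one_add_smul_bettiMapHom hHD hI hd hφ hE2 (by omega)
  -- the eigenvalue `μ = i√d` and the multiplicities `(2, 2)`
  have hsum := eigenMultiplicity_add_eigenMultiplicity_neg_eq_dim A φ hd hφ
  set μ : ℂ := Complex.I * (Real.sqrt d : ℂ) with hμdef
  have hμ : μ ^ 2 = -((d : ℚ) : ℂ) := by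
    rw [hμdef, mul_pow, Complex.I_sq, ← Complex.ofReal_pow, Real.sq_sqrt (Nat.cast_nonneg d),
      Complex.ofReal_natCast, Rat.cast_natCast, neg_one_mul]
  have hconj : starRingEnd ℂ μ = -μ := by
    rw [hμdef, map_mul, Complex.conj_I, Complex.conj_ofReal, neg_mul]
  have h22 : Module.finrank ℂ ↥(Module.End.eigenspace (φQ.baseChange ℂ) μ ⊓
        (BettiUniverse.hodge hHD (AbelianVariety.isSmoothProjective_holds (A := A)) 1).piece 1 0) = 2 ∧
      Module.finrank ℂ ↥(Module.End.eigenspace (φQ.baseChange ℂ) μ ⊓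
        (BettiUniverse.hodge hHD (AbelianVariety.isSmoothProjective_holds (A := A)) 1).piece 0 1) = 2 := by
    rw [hφQ, finrank_eigenspace_inf_piece_oneZero_eq_eigenMultiplicity hHD hI φ μ,
      finrank_eigenspace_inf_piece_zeroOne_eq_eigenMultiplicity_conj hHD hI φ μ, hconj]
    omega
  -- adapted dual bases, with `n₀ = dim A = 4` letters of each type
  obtain ⟨n₀, cb, κ, hcbW, hcbW', hcb0, hcb1, hdual⟩ := UnitaryTheta.exists_adaptedDualBasis
    (BettiUniverse.hodge hHD (AbelianVariety.isSmoothProjective_holds (A := A)) 1) Nat.cast_one heff ψ hφE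
    hdQ hφ2 hE hμ
  have hn₀ : n₀ = 4 := by
    have h1 := Module.finrank_eq_card_basis cb
    rw [Module.finrank_baseChange, Fintype.card_prod, Fintype.card_fin, Fintype.card_fin,
      Motives.AbelianVariety.finrank_bettiCohomology_one_eq_of_natCard_torsionPoints A
        (Motives.AbelianVariety.natCard_torsionPoints_of_isAlgClosed_holds A ℂ), hdim] at h1
    omega
  subst hn₀
  -- the eigen-relations of the letters
  obtain ⟨hμ0, -⟩ := UnitaryTheta.conj_eq_neg_of_sq hdQ hμ
  have hne : μ ≠ -μ := fun h => hμ0 (by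
    have h2 : (2 : ℂ) * μ = 0 := by rw [two_mul]; nth_rw 2 [h]; exact add_neg_cancel μ
    exact (mul_eq_zero.1 h2).resolve_left two_ne_zero)
  set L : Fin 2 × Fin 4 → complexBetti A.X 1 := fun tl =>
    ofRatClassBaseChange (Motives.ComplexPoints A.X) 1 (cb tl) with hLdef
  have he : ∀ i, VanGeemen1994.pullbackOne A φ (L (0, i)) = μ • L (0, i) := fun i => by
    have h := congrArg (ofRatClassBaseChange (Motives.ComplexPoints A.X) 1)
      (Module.End.mem_eigenspace_iff.1 (hcbW i))
    rw [hφQ, ofRatClassBaseChange_baseChange_bettiMapHom, map_smul] at h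
    exact h
  have hf : ∀ i, VanGeemen1994.pullbackOne A φ (L (1, i)) = (-μ) • L (1, i) := fun i => by
    have h := congrArg (ofRatClassBaseChange (Motives.ComplexPoints A.X) 1)
      (Module.End.mem_eigenspace_iff.1 (hcbW' i))
    rw [hφQ, ofRatClassBaseChange_baseChange_bettiMapHom, map_smul] at h
    exact h
  -- the crossed classes of `A`, in both orders, are divisor classes
  have hθ := sum_cupH1_adaptedDualBasis_mem_span_rational_oneOne hHD hI ψ hφE hdQ hφ2 hE hμ cb κ hcbW hcbW'
    hcb0 hcb1 hdual
  simp only [cupH1_apply] at hθ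
  have hθ' : (∑ i : Fin 4, cupProduct (rfl : 1 + 1 = 2) (L (1, i)) (L (0, i))) ∈
      Submodule.span ℂ {c : complexBetti A.X 2 | IsRationalClass c ∧ IsOfHodgeType A.dim A.X 2 1 1 c} := by
    have hanti : ∀ i : Fin 4, cupProduct (rfl : 1 + 1 = 2) (L (1, i)) (L (0, i)) =
        -cupProduct (rfl : 1 + 1 = 2) (L (0, i)) (L (1, i)) := fun i => by
      rw [cupProduct_gradedComm_holds ℂ (Motives.ComplexPoints A.X) (rfl : 1 + 1 = 2) rfl (L (1, i)) (L (0, i))]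
      simp
    simp_rw [hanti, Finset.sum_neg_distrib]
    exact Submodule.neg_mem _ hθ
  refine hg.hodgeClasses_algebraic_of_weilClasses_twoTwo hHD hI ψ hφE hdQ hφ2 hE hμ h22 cb κ hcbW hcbW' hcb0 hcb1
    hdual (fun j j' => ?_) (fun j j' => ?_) (fun j t => ?_) hcQ hc
  · exact Milne1999.sum_cross_mem_span_rational_oneOne_of_eigen φ (g j) (g j') (fun i => L (0, i))
      (fun i => L (1, i)) hne he hf hθ
  · exact Milne1999.sum_cross_mem_span_rational_oneOne_of_eigen φ (g j) (g j') (fun i => L (1, i))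
      (fun i => L (0, i)) hne.symm hf he hθ'
  · exact sum_sign_smul_cupPowOne_avLetters_mem_algebraicClasses_of_weilClassesOf g φ L he hf hW j t

/-- **The Hodge conjecture for the fourfold `A` of unitary type `(2,2)` implies the Hodge conjecture for every abelian
variety with slots over `A`** (all powers `Aⁿ`, all products of such): the Weil classes `W_K(A)` are Hodge classes on
`A` (van Geemen Lemma 5.2), so algebraic under `HC(A)`. [cite: MoonenZarhin1995Duke, main theorem (type IV(1,1), (2,2))]
[cite: vanGeemen1994HodgeAV, Lemma 5.2 and Thm. 6.12] -/
theorem AVSlots.hodgeConjectureFor_of_unitaryTwoTwo_of_hodgeConjectureFor (hg : AVSlots A B g) (φ : A ⟶ A) {d : ℕ}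
    (hd : 0 < d) (hφ : φ ≫ φ = -(d • 𝟙 A)) (hE2 : Module.finrank ℚ A.endAlgebra = 2)
    (h2a : 2 ≤ eigenMultiplicity A φ (Complex.I * (Real.sqrt d : ℂ)))
    (h2b : 2 ≤ eigenMultiplicity A φ (-(Complex.I * (Real.sqrt d : ℂ)))) (hdim : A.dim = 4)
    (hA : HodgeConjectureFor A.dim A.X) : HodgeConjectureFor B.dim B.X :=
  hg.hodgeConjectureFor_of_unitaryTwoTwo_of_weilClasses φ hd hφ hE2 h2a h2b hdim
    (weilClasses_algebraic_of_hodgeConjectureFor_of_unitaryTwoTwo A φ hd hφ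
      (eigenMultiplicity_eq_two_of_two_le A φ hd hφ hdim h2a h2b).1 hdim hA)

/-- **HC for every abelian variety with slots over a fourfold of unitary type `(2,2)`, GRANTED Markman's theorem on
the Weil classes of abelian fourfolds** (the tree's named fact `Markman2025_weilClasses_algebraic_abelianFourfold`, a
HYPOTHESIS here — claim under review). [cite: MoonenZarhin1995Duke, main theorem (type IV(1,1), (2,2))]
[claim: Markman2025SurveySecant, status: under-review] -/
theorem AVSlots.hodgeConjectureFor_of_unitaryTwoTwo_of_markman
    (hMark : Markman2025_weilClasses_algebraic_abelianFourfold) (hg : AVSlots A B g) (φ : A ⟶ A) {d : ℕ}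
    (hd : 0 < d) (hφ : φ ≫ φ = -(d • 𝟙 A)) (hE2 : Module.finrank ℚ A.endAlgebra = 2)
    (h2a : 2 ≤ eigenMultiplicity A φ (Complex.I * (Real.sqrt d : ℂ)))
    (h2b : 2 ≤ eigenMultiplicity A φ (-(Complex.I * (Real.sqrt d : ℂ)))) (hdim : A.dim = 4) :
    HodgeConjectureFor B.dim B.X :=
  hg.hodgeConjectureFor_of_unitaryTwoTwo_of_hodgeConjectureFor φ hd hφ hE2 h2a h2b hdim
    (Literature.AlgebraicGeometry.HodgeTheory.hodgeConjectureFor_of_unitaryTwoTwo_of_markman hMark A φ hd hφ hE2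
      h2a h2b hdim)

/-- **HC for all powers `A^{N+1}` of a fourfold of unitary type `(2,2)`, granted Markman's theorem** — Moonen–Zarhin
1995's «HC holds for all powers of X» in the row «IV(1,1), (2,2)», modulo the algebraicity of `W_K`.
[cite: MoonenZarhin1995Duke, main theorem (type IV(1,1), (2,2))] [claim: Markman2025SurveySecant, status: under-review] -/
theorem hodgeConjectureFor_powSucc_of_unitaryTwoTwo_of_markman
    (hMark : Markman2025_weilClasses_algebraic_abelianFourfold) (A : AbelianVariety ℂ) (φ : A ⟶ A) {d : ℕ}
    (hd : 0 < d) (hφ : φ ≫ φ = -(d • 𝟙 A)) (hE2 : Module.finrank ℚ A.endAlgebra = 2)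
    (h2a : 2 ≤ eigenMultiplicity A φ (Complex.I * (Real.sqrt d : ℂ)))
    (h2b : 2 ≤ eigenMultiplicity A φ (-(Complex.I * (Real.sqrt d : ℂ)))) (hdim : A.dim = 4) (N : ℕ) :
    HodgeConjectureFor (A.powSucc N).dim (A.powSucc N).X :=
  (AVSlots.powSucc A N).hodgeConjectureFor_of_unitaryTwoTwo_of_markman hMark φ hd hφ hE2 h2a h2b hdim

/-- **HC for every abelian variety with slots over a SIMPLE abelian fourfold of type IV(1,1) (`End⁰(A) = ℚ(φ)`
imaginary quadratic), granted Markman's theorem**: for simple `A` both multiplicities of `φ` are positive (Shimura; the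
tree's `AbelianVariety.eigenMultiplicity_pos_of_isSimple`); `(3,1)`/`(1,3)` is Ribet type — `B = D` UNCONDITIONALLY
(the tree's `AVSlots.isDivisorGenerated_of_ribetTypeOne`) — and `(2,2)` is
`AVSlots.hodgeConjectureFor_of_unitaryTwoTwo_of_markman`. Moonen–Zarhin 1995: «HC holds for all powers of X» for every
simple fourfold of type IV(1,1), modulo `W_K`. [cite: MoonenZarhin1995Duke, main theorem (type IV(1,1))] [cite: Ribet1983, Thm. 3]
[cite: MoonenZarhin1999LowDim, §2 (2.3)] [claim: Markman2025SurveySecant, status: under-review] -/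
theorem AVSlots.hodgeConjectureFor_of_isSimple_fourfold_of_finrank_end_eq_two_of_markman
    (hMark : Markman2025_weilClasses_algebraic_abelianFourfold) (hg : AVSlots A B g) (hA : A.IsSimple)
    (φ : A ⟶ A) {d : ℕ} (hd : 0 < d) (hφ : φ ≫ φ = -(d • 𝟙 A)) (hE2 : Module.finrank ℚ A.endAlgebra = 2)
    (hdim : A.dim = 4) : HodgeConjectureFor B.dim B.X := by
  obtain ⟨ha, hb⟩ := AbelianVariety.eigenMultiplicity_pos_of_isSimple A hA φ hd hφ (by omega)
  have hsum := eigenMultiplicity_add_eigenMultiplicity_neg_eq_dim A φ hd hφ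
  by_cases h1 : eigenMultiplicity A φ (Complex.I * (Real.sqrt d : ℂ)) = 1 ∨
      eigenMultiplicity A φ (-(Complex.I * (Real.sqrt d : ℂ))) = 1
  · exact hodgeConjectureFor_of_isDivisorGenerated _ (hg.isDivisorGenerated_of_ribetTypeOne φ hd hφ hE2 h1 (by omega))
  · push Not at h1
    exact hg.hodgeConjectureFor_of_unitaryTwoTwo_of_markman hMark φ hd hφ hE2 (by omega) (by omega) hdim

/-- **HC for all powers `A^{N+1}` of a simple abelian fourfold of type IV(1,1), granted Markman's theorem.**
[cite: MoonenZarhin1995Duke, main theorem (type IV(1,1))] [claim: Markman2025SurveySecant, status: under-review] -/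
theorem hodgeConjectureFor_powSucc_of_isSimple_fourfold_of_finrank_end_eq_two_of_markman
    (hMark : Markman2025_weilClasses_algebraic_abelianFourfold) (A : AbelianVariety ℂ) (hA : A.IsSimple)
    (φ : A ⟶ A) {d : ℕ} (hd : 0 < d) (hφ : φ ≫ φ = -(d • 𝟙 A)) (hE2 : Module.finrank ℚ A.endAlgebra = 2)
    (hdim : A.dim = 4) (N : ℕ) : HodgeConjectureFor (A.powSucc N).dim (A.powSucc N).X :=
  (AVSlots.powSucc A N).hodgeConjectureFor_of_isSimple_fourfold_of_finrank_end_eq_two_of_markman hMark hA φ hd hφ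
    hE2 hdim

end Geometric

end Literature.AlgebraicGeometry.HodgeTheory

end
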